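import Summits.AtomisticToContinuum.FouriersLaw.Theorems.RobinCoercivity.Negative.SchurPositivity
import Summits.AtomisticToContinuum.FouriersLaw.Theorems.HonestZwanzigOrthogonalOhmRegressionIdentity
import Summits.AtomisticToContinuum.FouriersLaw.Theorems.HonestZwanzigPositiveMemoryProfileForm
import Summits.AtomisticToContinuum.FouriersLaw.Theorems.HonestZwanzigRobinCoercivityStubFeshbachIdentities

/-!
# `HonestZwanzig.RobinCoercivity` — Liouville coboundaries are invisible to `lap_s` at zero frequency

Support file for the crux `stmt-AtomisticToContinuum-12695` (`RobinCoercivity`, route `HonestZwanzig`, sub-problem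
`FouriersLaw`): the fixed-`N` identities that retire line Sketch (card free-coboundary-thomson-flow) of the crux chain
(`Cruxes/RobinCoercivity/Lines/Sketch-dead.md`, lead c1). Everything is over the route's abstract gadgets
(`Adm, corr, lap, cov` with their defining equations, and the fixed-`N` package `hFI` of `FeshbachIdentities`, exactly as in
`…NetworkReductionPackage` / `Theorems/RobinCoercivity/Negative/*`), so the lemmas apply verbatim inside any file of the chain.

A DYNKIN PAIR `(v, ℓ)` means `P_r v − v = ∫₀ʳ P_u ℓ du` pointwise for the constructed kernels (so `ℓ = Lv`); `Θ(q,p) = (q,−p)`.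

* `kolmogorov_second` — the package's second-slot Kolmogorov identity for a general Dynkin pair:
  `s·lap_s(f, v) − cov(f, v) = lap_s(f, ℓ)` (`pinnedChain_kolmogorov_lap` in gadget form).
* `kolmogorov_first` — the first-slot identity WITHOUT evenness: `s·lap_s(v∘Θ, g) − cov(v∘Θ, g) = lap_s(ℓ∘Θ, g)`.
* `lap_coboundary_self`, `lap_add_coboundary` — for a BULK coboundary (Dynkin pairs `(w, ℓ)`, `(w∘Θ, ℓ')` with
  `ℓ'∘Θ = −ℓ`, i.e. `L†w = −Lw`: `w` is not touched by the two bath operators, `ℓ = Aw` is its Liouville derivative):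
  `cov(w, ℓ) = 0`, `lap_s(ℓ,ℓ) = s·cov(w,w) − s²·lap_s(w,w)`, and for admissible `f`
  `lap_s(f + ℓ, f + ℓ) = lap_s(f,f) + s·(lap_s(f,w) − lap_s(w,f)) + s·cov(w,w) − s²·lap_s(w,w)`.
  So `lap_s(f + Aw, f + Aw) − lap_s(f,f) = O(s)` at fixed `N`: adding the Liouville derivative of ANY bulk observable does not
  change the zero-frequency autocorrelation integral — every inf-side "certificate step" `√lap(f) ≤ ‖w‖_B + √lap(f + Aw)` with
  bulk-local correctors is an identity at `s ↓ 0`, which is why line Sketch cannot certify bulk profiles.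
* `lap_coboundary_dissipation` — the general free-coboundary identity: with `a := (ℓ − ℓ'∘Θ)/2` (`= Aw`) and
  `b := s·w − (ℓ + ℓ'∘Θ)/2` (`= (s − γS)w`), `lap_s(a,a) + lap_s(b,b) = cov(w,b) − cov(a,w)`.
* `coboundaryInvariance` — the headline identity for the CANONICAL objects (no gadget hypotheses; the package is supplied
  by `feshbachIdentities_of`).
All are consequences of the two Kolmogorov identities and bilinearity alone (small two-slot bilinearity lemmas for `lap_s`,
`cov` are included; first-slot additivity, time reversal and products come from `NetworkReduction.Bilinear`,
`OrthogonalOhmLine.RegressionIdentity.lapR_add`, `PositiveMemory.pf_integrable_mul`). [folklore]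
-/

noncomputable section

open MeasureTheory Finset Real Set Filter ProbabilityTheory
open scoped NNReal
open Literature.MathematicalPhysics.KineticTheory.HeatConduction
open Summit.AtomisticToContinuum.FouriersLaw.Theorems.HonestZwanzig.NetworkReduction

namespace Summit.AtomisticToContinuum.FouriersLaw.Theorems.HonestZwanzig.Robin

section Coboundary

variable {ω₂ lam β γ : ℝ} {N : ℕ} {T : ℝ}
  {Adm : (PhaseSpace N → ℝ) → Prop}
  {corr : (PhaseSpace N → ℝ) → (PhaseSpace N → ℝ) → ℝ → ℝ}
  {lap : ℝ → (PhaseSpace N → ℝ) → (PhaseSpace N → ℝ) → ℝ}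
  {cov : (PhaseSpace N → ℝ) → (PhaseSpace N → ℝ) → ℝ}
  {e : Fin N → PhaseSpace N → ℝ}
  (hAdm : ∀ f, Adm f ↔ (Continuous f ∧ ∃ A : ℝ, ∀ z,
    |f z| ≤ A * Real.exp ((pinnedChain ω₂ lam β γ).hamiltonian N z / (8 * T))))
  (hcorr : ∀ f g t, corr f g t =
    (∫ z, f z * (∫ y, g y ∂((pinnedChain ω₂ lam β γ).transitionKernel N T T t.toNNReal z))
      ∂(pinnedChain ω₂ lam β γ).gibbsMeasure N T) -
    (∫ z, f z ∂(pinnedChain ω₂ lam β γ).gibbsMeasure N T) *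
      (∫ z, g z ∂(pinnedChain ω₂ lam β γ).gibbsMeasure N T))
  (hlap : ∀ s f g, lap s f g = ∫ t in Set.Ioi (0 : ℝ), Real.exp (-(s * t)) * corr f g t)
  (hcov : ∀ f g, cov f g = (∫ z, f z * g z ∂(pinnedChain ω₂ lam β γ).gibbsMeasure N T) -
    (∫ z, f z ∂(pinnedChain ω₂ lam β γ).gibbsMeasure N T) *
      (∫ z, g z ∂(pinnedChain ω₂ lam β γ).gibbsMeasure N T))
  (hFI : ∀ f g : PhaseSpace N → ℝ, Adm f → Adm g →
    Integrable f ((pinnedChain ω₂ lam β γ).gibbsMeasure N T) ∧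
    (∀ t : ℝ, 0 ≤ t → Integrable (fun z => f z *
      (∫ y, g y ∂((pinnedChain ω₂ lam β γ).transitionKernel N T T t.toNNReal z)))
      ((pinnedChain ω₂ lam β γ).gibbsMeasure N T)) ∧
    IntegrableOn (corr f g) (Set.Ioi 0) ∧
    (∀ t : ℝ, 0 ≤ t → corr f g t = corr (fun z => g (z.1, -z.2)) (fun z => f (z.1, -z.2)) t) ∧
    (∀ s : ℝ, 0 < s → ∀ x : Fin N,
      s * lap s (e x) g - cov (e x) g =
        lap s (fun z => (pinnedChain ω₂ lam β γ).generator N T T (e x) (z.1, -z.2)) g ∧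
      s * lap s f (e x) - cov f (e x) = lap s f ((pinnedChain ω₂ lam β γ).generator N T T (e x))))
  (hω : 0 < ω₂) (hl : 0 ≤ lam) (hβ : 0 < β) (hγ : 0 < γ) (hN : 0 < N) (hT : 0 < T)

/-! ### Small gadget algebra (admissible observables) -/

include hcov hAdm hFI hω hl hβ hT in
/-- `cov(f₁ + f₂, g) = cov(f₁, g) + cov(f₂, g)` for admissible observables. -/
theorem cov_add_left {f₁ f₂ g : PhaseSpace N → ℝ} (h₁ : Adm f₁) (h₂ : Adm f₂) (hg : Adm g) :
    cov (fun z => f₁ z + f₂ z) g = cov f₁ g + cov f₂ g := by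
  rw [hcov, hcov, hcov]
  simp_rw [add_mul]
  rw [integral_add (PositiveMemory.pf_integrable_mul hAdm hω hl hβ.le hT h₁ hg) (PositiveMemory.pf_integrable_mul hAdm hω hl hβ.le hT h₂ hg),
    integral_add (hFI f₁ g h₁ hg).1 (hFI f₂ g h₂ hg).1]
  ring

include hcov hAdm hFI hω hl hβ hT in
/-- `cov(f, g₁ + g₂) = cov(f, g₁) + cov(f, g₂)` for admissible observables. -/
theorem cov_add_right {f g₁ g₂ : PhaseSpace N → ℝ} (hf : Adm f) (h₁ : Adm g₁) (h₂ : Adm g₂) :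
    cov f (fun z => g₁ z + g₂ z) = cov f g₁ + cov f g₂ := by
  rw [cov_comm hcov, cov_add_left hAdm hcov hFI hω hl hβ hT h₁ h₂ hf, cov_comm hcov g₁, cov_comm hcov g₂]

include hcov in
/-- `cov(f, c·g) = c·cov(f, g)`. -/
theorem cov_const_mul_right (c : ℝ) (f g : PhaseSpace N → ℝ) :
    cov f (fun z => c * g z) = c * cov f g := by
  rw [cov_comm hcov, cov_const_mul_left hcov, cov_comm hcov]

include hcov in
/-- Momentum reversal moves between the two slots of `cov` (the Gibbs state is `Θ`-invariant). -/
theorem cov_rev (f g : PhaseSpace N → ℝ) :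
    cov (fun z => f (z.1, -z.2)) g = cov (fun z => g (z.1, -z.2)) f := by
  rw [hcov, hcov]
  have h1 : ∫ z, f (z.1, -z.2) * g z ∂(pinnedChain ω₂ lam β γ).gibbsMeasure N T =
      ∫ z, g (z.1, -z.2) * f z ∂(pinnedChain ω₂ lam β γ).gibbsMeasure N T := by
    have h := OddSectorIrreversibility.integral_comp_reversal_gibbsMeasure (pinnedChain ω₂ lam β γ) N T
      (fun z => g (z.1, -z.2) * f z)
    have e1 : (fun z : PhaseSpace N => (fun w : PhaseSpace N => g (w.1, -w.2) * f w) (z.1, -z.2)) =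
        fun z => f (z.1, -z.2) * g z := by
      funext z
      simp only [neg_neg, Prod.mk.eta, mul_comm]
    rw [e1] at h
    exact h
  rw [h1, OddSectorIrreversibility.integral_comp_reversal_gibbsMeasure (pinnedChain ω₂ lam β γ) N T f,
    OddSectorIrreversibility.integral_comp_reversal_gibbsMeasure (pinnedChain ω₂ lam β γ) N T g, mul_comm]

include hAdm hcorr hlap hFI in
/-- `lap_s(c₁f₁ + c₂f₂, g) = c₁ lap_s(f₁,g) + c₂ lap_s(f₂,g)`. -/
theorem lap_lin_left {f₁ f₂ g : PhaseSpace N → ℝ} (h₁ : Adm f₁) (h₂ : Adm f₂) (hg : Adm g) (c₁ c₂ : ℝ)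
    {s : ℝ} (hs : 0 ≤ s) :
    lap s (fun z => c₁ * f₁ z + c₂ * f₂ z) g = c₁ * lap s f₁ g + c₂ * lap s f₂ g := by
  rw [lap_add_left hcorr hlap hFI (adm_const_mul Adm hAdm c₁ h₁) (adm_const_mul Adm hAdm c₂ h₂) hg hs,
    lap_const_mul_left hcorr hlap, lap_const_mul_left hcorr hlap]

include hAdm hcorr hlap hFI in
/-- `lap_s(f, c₁g₁ + c₂g₂) = c₁ lap_s(f,g₁) + c₂ lap_s(f,g₂)`. -/
theorem lap_lin_right {f g₁ g₂ : PhaseSpace N → ℝ} (hf : Adm f) (h₁ : Adm g₁) (h₂ : Adm g₂) (c₁ c₂ : ℝ)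
    {s : ℝ} (hs : 0 ≤ s) :
    lap s f (fun z => c₁ * g₁ z + c₂ * g₂ z) = c₁ * lap s f g₁ + c₂ * lap s f g₂ := by
  rw [OrthogonalOhmLine.RegressionIdentity.lapR_add hAdm hcorr hlap hFI hf (adm_const_mul Adm hAdm c₁ h₁) (adm_const_mul Adm hAdm c₂ h₂) hs,
    lap_const_mul_right hcorr hlap, lap_const_mul_right hcorr hlap]

include hcov hAdm hFI hω hl hβ hT in
/-- `cov(c₁f₁ + c₂f₂, g) = c₁ cov(f₁,g) + c₂ cov(f₂,g)`. -/
theorem cov_lin_left {f₁ f₂ g : PhaseSpace N → ℝ} (h₁ : Adm f₁) (h₂ : Adm f₂) (hg : Adm g) (c₁ c₂ : ℝ) :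
    cov (fun z => c₁ * f₁ z + c₂ * f₂ z) g = c₁ * cov f₁ g + c₂ * cov f₂ g := by
  rw [cov_add_left hAdm hcov hFI hω hl hβ hT (adm_const_mul Adm hAdm c₁ h₁) (adm_const_mul Adm hAdm c₂ h₂) hg,
    cov_const_mul_left hcov, cov_const_mul_left hcov]

include hcov hAdm hFI hω hl hβ hT in
/-- `cov(f, c₁g₁ + c₂g₂) = c₁ cov(f,g₁) + c₂ cov(f,g₂)`. -/
theorem cov_lin_right {f g₁ g₂ : PhaseSpace N → ℝ} (hf : Adm f) (h₁ : Adm g₁) (h₂ : Adm g₂) (c₁ c₂ : ℝ) :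
    cov f (fun z => c₁ * g₁ z + c₂ * g₂ z) = c₁ * cov f g₁ + c₂ * cov f g₂ := by
  rw [cov_add_right hAdm hcov hFI hω hl hβ hT hf (adm_const_mul Adm hAdm c₁ h₁) (adm_const_mul Adm hAdm c₂ h₂),
    cov_const_mul_right hcov, cov_const_mul_right hcov]

/-! ### The two Kolmogorov identities for general Dynkin pairs -/

include hAdm hcorr hlap hcov hω hl hβ hγ hN hT in
/-- **Second-slot Kolmogorov identity** (gadget form of `pinnedChain_kolmogorov_lap`): for admissible `f` and a Dynkin
pair `(v, ℓ)` of admissible observables, `s·lap_s(f, v) − cov(f, v) = lap_s(f, ℓ)` for every `s > 0`.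
[cite: CuneoEckmannHairerReyBellet2018, §3 p. 7] -/
theorem kolmogorov_second {f v ℓ : PhaseSpace N → ℝ} (hf : Adm f) (hv : Adm v) (hℓ : Adm ℓ)
    (hdyn : ∀ (r : ℝ≥0) (z : PhaseSpace N),
      (∫ y, v y ∂((pinnedChain ω₂ lam β γ).transitionKernel N T T r z)) - v z =
        ∫ s in (0 : ℝ)..(r : ℝ), ∫ y, ℓ y ∂((pinnedChain ω₂ lam β γ).transitionKernel N T T s.toNNReal z))
    {s : ℝ} (hs : 0 < s) :
    s * lap s f v - cov f v = lap s f ℓ := by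
  obtain ⟨hfc, Cf, hCf, hfb⟩ := RobinCoercivity.Negative.adm_nice hAdm hf
  obtain ⟨hvc, Cv, hCv, hvb⟩ := RobinCoercivity.Negative.adm_nice hAdm hv
  obtain ⟨hℓc, Cℓ, hCℓ, hℓb⟩ := RobinCoercivity.Negative.adm_nice hAdm hℓ
  have hϑ0 : 0 < 1 / (8 * T) := by positivity
  have h2ϑ : 2 * (1 / (8 * T)) < 1 / T := by
    rw [show 2 * (1 / (8 * T)) = 1 / (4 * T) by ring]
    exact one_div_lt_one_div_of_lt hT (by linarith)
  rw [hlap, hlap, hcov]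
  simp only [hcorr]
  exact pinnedChain_kolmogorov_lap hω hl hβ hγ hN hT hϑ0 h2ϑ hfc hvc hℓc hCf hCv hCℓ hfb hvb hℓb hdyn hs

include hAdm hcorr hlap hcov hFI hω hl hβ hγ hN hT in
/-- **First-slot Kolmogorov identity, general observables** (no evenness): for admissible `g` and a Dynkin pair `(v, ℓ)`,
`s·lap_s(v∘Θ, g) − cov(v∘Θ, g) = lap_s(ℓ∘Θ, g)` for every `s > 0` — time reversal twice around `kolmogorov_second`.
[cite: CuneoEckmannHairerReyBellet2018, §3.1] -/
theorem kolmogorov_first {g v ℓ : PhaseSpace N → ℝ} (hg : Adm g) (hv : Adm v) (hℓ : Adm ℓ)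
    (hdyn : ∀ (r : ℝ≥0) (z : PhaseSpace N),
      (∫ y, v y ∂((pinnedChain ω₂ lam β γ).transitionKernel N T T r z)) - v z =
        ∫ s in (0 : ℝ)..(r : ℝ), ∫ y, ℓ y ∂((pinnedChain ω₂ lam β γ).transitionKernel N T T s.toNNReal z))
    {s : ℝ} (hs : 0 < s) :
    s * lap s (fun z => v (z.1, -z.2)) g - cov (fun z => v (z.1, -z.2)) g =
      lap s (fun z => ℓ (z.1, -z.2)) g := by
  have hgr : Adm (fun z => g (z.1, -z.2)) := adm_rev Adm hAdm hg
  have hvr : Adm (fun z => v (z.1, -z.2)) := adm_rev Adm hAdm hv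
  have hℓr : Adm (fun z => ℓ (z.1, -z.2)) := adm_rev Adm hAdm hℓ
  have e1 : (fun z : PhaseSpace N => (fun w : PhaseSpace N => v (w.1, -w.2)) (z.1, -z.2)) = v := by
    funext z; simp
  have e2 : (fun z : PhaseSpace N => (fun w : PhaseSpace N => ℓ (w.1, -w.2)) (z.1, -z.2)) = ℓ := by
    funext z; simp
  have r1 : lap s (fun z => v (z.1, -z.2)) g = lap s (fun z => g (z.1, -z.2)) v := by
    rw [lap_rev hlap hFI hvr hg s, e1]
  have r2 : lap s (fun z => ℓ (z.1, -z.2)) g = lap s (fun z => g (z.1, -z.2)) ℓ := by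
    rw [lap_rev hlap hFI hℓr hg s, e2]
  rw [r1, r2, cov_rev hcov v g]
  exact kolmogorov_second hAdm hcorr hlap hcov hω hl hβ hγ hN hT hgr hv hℓ hdyn hs

include hAdm hcorr hlap hcov hFI hω hl hβ hγ hN hT in
/-- The first-slot identity for the pair `(w∘Θ, ℓ')`: `s·lap_s(w, g) − cov(w, g) = lap_s(ℓ'∘Θ, g)` (`ℓ'∘Θ = L†w`). -/
theorem kolmogorov_first' {g w ℓ' : PhaseSpace N → ℝ} (hg : Adm g) (hw : Adm w) (hℓ' : Adm ℓ')
    (hdyn' : ∀ (r : ℝ≥0) (z : PhaseSpace N),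
      (∫ y, w (y.1, -y.2) ∂((pinnedChain ω₂ lam β γ).transitionKernel N T T r z)) - w (z.1, -z.2) =
        ∫ s in (0 : ℝ)..(r : ℝ), ∫ y, ℓ' y ∂((pinnedChain ω₂ lam β γ).transitionKernel N T T s.toNNReal z))
    {s : ℝ} (hs : 0 < s) :
    s * lap s w g - cov w g = lap s (fun z => ℓ' (z.1, -z.2)) g := by
  have hwr : Adm (fun z => w (z.1, -z.2)) := adm_rev Adm hAdm hw
  have h := kolmogorov_first hAdm hcorr hlap hcov hFI hω hl hβ hγ hN hT hg hwr hℓ' hdyn' hs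
  have e1 : (fun z : PhaseSpace N => (fun y : PhaseSpace N => w (y.1, -y.2)) (z.1, -z.2)) = w := by
    funext z; simp
  simpa only [e1] using h

/-! ### Bulk coboundaries are invisible at zero frequency -/

include hAdm hcorr hlap hcov hFI hω hl hβ hγ hN hT in
/-- **A bulk Liouville coboundary has `cov(w, Aw) = 0` and `lap_s(Aw, Aw) = s·Var(w) − s²·lap_s(w,w)`.** Here `(w, ℓ)`
and `(w∘Θ, ℓ')` are Dynkin pairs of admissible observables with `ℓ'∘Θ = −ℓ` (`L†w = −Lw`: `w` is not touched by the two
bath operators, so `ℓ = Aw`). Pure consequence of the two Kolmogorov identities. [folklore] -/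
theorem lap_coboundary_self {w ℓ ℓ' : PhaseSpace N → ℝ} (hw : Adm w) (hℓ : Adm ℓ) (hℓ' : Adm ℓ')
    (hdyn : ∀ (r : ℝ≥0) (z : PhaseSpace N),
      (∫ y, w y ∂((pinnedChain ω₂ lam β γ).transitionKernel N T T r z)) - w z =
        ∫ s in (0 : ℝ)..(r : ℝ), ∫ y, ℓ y ∂((pinnedChain ω₂ lam β γ).transitionKernel N T T s.toNNReal z))
    (hdyn' : ∀ (r : ℝ≥0) (z : PhaseSpace N),
      (∫ y, w (y.1, -y.2) ∂((pinnedChain ω₂ lam β γ).transitionKernel N T T r z)) - w (z.1, -z.2) =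
        ∫ s in (0 : ℝ)..(r : ℝ), ∫ y, ℓ' y ∂((pinnedChain ω₂ lam β γ).transitionKernel N T T s.toNNReal z))
    (hbulk : ∀ z : PhaseSpace N, ℓ' (z.1, -z.2) = -ℓ z) {s : ℝ} (hs : 0 < s) :
    cov w ℓ = 0 ∧ lap s ℓ ℓ = s * cov w w - s ^ 2 * lap s w w := by
  have em : (fun z : PhaseSpace N => ℓ' (z.1, -z.2)) = fun z => (-1) * ℓ z := by
    funext z; rw [hbulk z]; ring
  -- the four Kolmogorov relations
  have k1 := kolmogorov_second hAdm hcorr hlap hcov hω hl hβ hγ hN hT hw hw hℓ hdyn hs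
  have k2 := kolmogorov_first' hAdm hcorr hlap hcov hFI hω hl hβ hγ hN hT hw hw hℓ' hdyn' hs
  have k3 := kolmogorov_second hAdm hcorr hlap hcov hω hl hβ hγ hN hT hℓ hw hℓ hdyn hs
  have k4 := kolmogorov_first' hAdm hcorr hlap hcov hFI hω hl hβ hγ hN hT hℓ hw hℓ' hdyn' hs
  rw [em, lap_const_mul_left hcorr hlap] at k2 k4
  have hc : cov ℓ w = cov w ℓ := cov_comm hcov ℓ w
  rw [hc] at k3
  constructor
  · linear_combination (-(1:ℝ)/2) * k3 + (-(1:ℝ)/2) * k4 + (-s/2) * k1 + (s/2) * k2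
  · linear_combination (-(1:ℝ)/2) * k3 + ((1:ℝ)/2) * k4 + (s/2) * k1 + (s/2) * k2

include hAdm hcorr hlap hcov hFI hω hl hβ hγ hN hT in
/-- **Coboundary invariance of the Laplace-transformed autocorrelation.** With `(w, ℓ, ℓ')` a bulk Liouville coboundary as
in `lap_coboundary_self` (`ℓ = Aw`) and `f` admissible, for every `s > 0`:
`lap_s(f + ℓ, f + ℓ) = lap_s(f,f) + s·(lap_s(f,w) − lap_s(w,f)) + s·Var(w) − s²·lap_s(w,w)`.
In particular `lap_s(f + Aw, f + Aw) − lap_s(f,f) → 0` as `s ↓ 0` at fixed `N`: the Liouville derivative of a bulk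
observable is invisible at zero frequency, so inf-side certificates built from bulk-local correctors cannot improve a
zero-frequency bound (the reason line Sketch of crux stmt-AtomisticToContinuum-12695 is dead). [folklore] -/
theorem lap_add_coboundary {f w ℓ ℓ' : PhaseSpace N → ℝ} (hf : Adm f) (hw : Adm w) (hℓ : Adm ℓ) (hℓ' : Adm ℓ')
    (hdyn : ∀ (r : ℝ≥0) (z : PhaseSpace N),
      (∫ y, w y ∂((pinnedChain ω₂ lam β γ).transitionKernel N T T r z)) - w z =
        ∫ s in (0 : ℝ)..(r : ℝ), ∫ y, ℓ y ∂((pinnedChain ω₂ lam β γ).transitionKernel N T T s.toNNReal z))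
    (hdyn' : ∀ (r : ℝ≥0) (z : PhaseSpace N),
      (∫ y, w (y.1, -y.2) ∂((pinnedChain ω₂ lam β γ).transitionKernel N T T r z)) - w (z.1, -z.2) =
        ∫ s in (0 : ℝ)..(r : ℝ), ∫ y, ℓ' y ∂((pinnedChain ω₂ lam β γ).transitionKernel N T T s.toNNReal z))
    (hbulk : ∀ z : PhaseSpace N, ℓ' (z.1, -z.2) = -ℓ z) {s : ℝ} (hs : 0 < s) :
    lap s (fun z => f z + ℓ z) (fun z => f z + ℓ z) =
      lap s f f + s * (lap s f w - lap s w f) + s * cov w w - s ^ 2 * lap s w w := by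
  obtain ⟨hc0, hself⟩ := lap_coboundary_self hAdm hcorr hlap hcov hFI hω hl hβ hγ hN hT hw hℓ hℓ' hdyn hdyn' hbulk hs
  have em : (fun z : PhaseSpace N => ℓ' (z.1, -z.2)) = fun z => (-1) * ℓ z := by
    funext z; rw [hbulk z]; ring
  have hfl : Adm (fun z => f z + ℓ z) := adm_add Adm hAdm hf hℓ
  -- expand the square
  rw [lap_add_left hcorr hlap hFI hf hℓ hfl hs.le, OrthogonalOhmLine.RegressionIdentity.lapR_add hAdm hcorr hlap hFI hf hf hℓ hs.le,
    OrthogonalOhmLine.RegressionIdentity.lapR_add hAdm hcorr hlap hFI hℓ hf hℓ hs.le]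
  have k1 := kolmogorov_second hAdm hcorr hlap hcov hω hl hβ hγ hN hT hf hw hℓ hdyn hs
  have k2 := kolmogorov_first' hAdm hcorr hlap hcov hFI hω hl hβ hγ hN hT hf hw hℓ' hdyn' hs
  rw [em, lap_const_mul_left hcorr hlap] at k2
  have hcs : cov f w = cov w f := cov_comm hcov f w
  rw [hcs] at k1
  linear_combination hself - k1 + k2

/-! ### The general free-coboundary identity -/

include hAdm hcorr hlap hcov hFI hω hl hβ hγ hN hT in
/-- **The free-coboundary identity (general observables).** For Dynkin pairs `(w, ℓ)`, `(w∘Θ, ℓ')` of admissible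
observables put `a := (ℓ − ℓ'∘Θ)/2` (the Liouville part `Aw = ½(L − L†)w`) and `b := s·w − (ℓ + ℓ'∘Θ)/2`
(`= (s − γS)w`). Then for every `s > 0`: `lap_s(a,a) + lap_s(b,b) = cov(w,b) − cov(a,w)`. With the static identities
`cov(Aw,w) = 0`, `cov(w,(s−γS)w) = s·Var w + γT Σ_∂‖∂_p w‖²` and `lap_s(b,b) ≥ 0` this is the free-coboundary inequality
`lap_s(Aw,Aw) ≤ s·Var w + γT Σ_∂‖∂_p w‖²`; with `w ↦ B⁻¹h` it is the bath-absorption bound `lap_s(h,h) ≤ ⟨h, B⁻¹h⟩`.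
[folklore] -/
theorem lap_coboundary_dissipation {w ℓ ℓ' : PhaseSpace N → ℝ} (hw : Adm w) (hℓ : Adm ℓ) (hℓ' : Adm ℓ')
    (hdyn : ∀ (r : ℝ≥0) (z : PhaseSpace N),
      (∫ y, w y ∂((pinnedChain ω₂ lam β γ).transitionKernel N T T r z)) - w z =
        ∫ s in (0 : ℝ)..(r : ℝ), ∫ y, ℓ y ∂((pinnedChain ω₂ lam β γ).transitionKernel N T T s.toNNReal z))
    (hdyn' : ∀ (r : ℝ≥0) (z : PhaseSpace N),
      (∫ y, w (y.1, -y.2) ∂((pinnedChain ω₂ lam β γ).transitionKernel N T T r z)) - w (z.1, -z.2) =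
        ∫ s in (0 : ℝ)..(r : ℝ), ∫ y, ℓ' y ∂((pinnedChain ω₂ lam β γ).transitionKernel N T T s.toNNReal z))
    {s : ℝ} (hs : 0 < s) :
    lap s (fun z => (ℓ z - ℓ' (z.1, -z.2)) / 2) (fun z => (ℓ z - ℓ' (z.1, -z.2)) / 2) +
      lap s (fun z => s * w z - (ℓ z + ℓ' (z.1, -z.2)) / 2) (fun z => s * w z - (ℓ z + ℓ' (z.1, -z.2)) / 2) =
    cov w (fun z => s * w z - (ℓ z + ℓ' (z.1, -z.2)) / 2) - cov (fun z => (ℓ z - ℓ' (z.1, -z.2)) / 2) w := by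
  set m : PhaseSpace N → ℝ := fun z => ℓ' (z.1, -z.2) with hm
  set a : PhaseSpace N → ℝ := fun z => (ℓ z - ℓ' (z.1, -z.2)) / 2 with ha
  set b : PhaseSpace N → ℝ := fun z => s * w z - (ℓ z + ℓ' (z.1, -z.2)) / 2 with hb
  have hmA : Adm m := adm_rev Adm hAdm hℓ'
  have haA : Adm a := by
    refine adm_of_eq Adm (fun z => ?_) (adm_const_mul Adm hAdm (1 / 2) (adm_sub Adm hAdm hℓ hmA))
    simp only [ha, hm]; ring
  have hbA : Adm b := by
    refine adm_of_eq Adm (fun z => ?_)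
      (adm_sub Adm hAdm (adm_const_mul Adm hAdm s hw) (adm_const_mul Adm hAdm (1 / 2) (adm_add Adm hAdm hℓ hmA)))
    simp only [hb, hm]; ring
  -- ℓ = a + (s·w − b) and m = s·w − a − b, written as linear combinations
  have eℓ : ℓ = fun z => (1 : ℝ) * a z + (1 : ℝ) * (fun y => s * w y + (-1 : ℝ) * b y) z := by
    funext z; simp only [ha, hb]; ring
  have em : m = fun z => s * w z + (1 : ℝ) * (fun y => (-1 : ℝ) * a y + (-1 : ℝ) * b y) z := by
    funext z; simp only [hm, ha, hb]; ring
  have hswb : Adm (fun y => s * w y + (-1 : ℝ) * b y) :=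
    adm_add Adm hAdm (adm_const_mul Adm hAdm s hw) (adm_const_mul Adm hAdm (-1) hbA)
  have hab : Adm (fun y => (-1 : ℝ) * a y + (-1 : ℝ) * b y) :=
    adm_add Adm hAdm (adm_const_mul Adm hAdm (-1) haA) (adm_const_mul Adm hAdm (-1) hbA)
  -- (†) K1 with f := a
  have k1 := kolmogorov_second hAdm hcorr hlap hcov hω hl hβ hγ hN hT haA hw hℓ hdyn hs
  rw [eℓ, lap_lin_right hAdm hcorr hlap hFI haA haA hswb 1 1 hs.le,
    lap_lin_right hAdm hcorr hlap hFI haA hw hbA s (-1) hs.le] at k1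
  -- (‡) K2 with g := b
  have k2 := kolmogorov_first' hAdm hcorr hlap hcov hFI hω hl hβ hγ hN hT hbA hw hℓ' hdyn' hs
  rw [show (fun z : PhaseSpace N => ℓ' (z.1, -z.2)) = m from rfl, em,
    lap_lin_left hAdm hcorr hlap hFI hw hab hbA s 1 hs.le,
    lap_lin_left hAdm hcorr hlap hFI haA hbA hbA (-1) (-1) hs.le] at k2
  linear_combination -k1 + k2


end Coboundary

/-! ### The headline identity for the canonical objects (no gadget hypotheses) -/

/-- **Coboundary invariance, canonical form.** For `pinnedChain ω₂ lam β γ` (`ω₂, β, γ > 0`, `lam ≥ 0`), `N ≥ 2`, `T > 0`,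
admissible observables `f, w, ℓ, ℓ'` (continuous, `O(e^{H/(8T)})`) with Dynkin pairs `(w, ℓ)`, `(w∘Θ, ℓ')` for the
equilibrium kernels and `ℓ'∘Θ = −ℓ` (a bulk Liouville coboundary `ℓ = Aw`), and every `s > 0`:
`lap_s(f+ℓ, f+ℓ) = lap_s(f,f) + s·(lap_s(f,w) − lap_s(w,f)) + s·Var(w) − s²·lap_s(w,w)` for the route's `lap_s`, `cov`.
[folklore] -/
theorem coboundaryInvariance {ω₂ lam β γ : ℝ} {N : ℕ} {T : ℝ} (hω : 0 < ω₂) (hl : 0 ≤ lam) (hβ : 0 < β)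
    (hγ : 0 < γ) (hN : 2 ≤ N) (hT : 0 < T) {f w ℓ ℓ' : PhaseSpace N → ℝ}
    (hf : Continuous f ∧ ∃ A : ℝ, ∀ z, |f z| ≤ A * Real.exp ((pinnedChain ω₂ lam β γ).hamiltonian N z / (8 * T)))
    (hw : Continuous w ∧ ∃ A : ℝ, ∀ z, |w z| ≤ A * Real.exp ((pinnedChain ω₂ lam β γ).hamiltonian N z / (8 * T)))
    (hℓ : Continuous ℓ ∧ ∃ A : ℝ, ∀ z, |ℓ z| ≤ A * Real.exp ((pinnedChain ω₂ lam β γ).hamiltonian N z / (8 * T)))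
    (hℓ' : Continuous ℓ' ∧ ∃ A : ℝ, ∀ z, |ℓ' z| ≤ A * Real.exp ((pinnedChain ω₂ lam β γ).hamiltonian N z / (8 * T)))
    (hdyn : ∀ (r : ℝ≥0) (z : PhaseSpace N),
      (∫ y, w y ∂((pinnedChain ω₂ lam β γ).transitionKernel N T T r z)) - w z =
        ∫ s in (0 : ℝ)..(r : ℝ), ∫ y, ℓ y ∂((pinnedChain ω₂ lam β γ).transitionKernel N T T s.toNNReal z))
    (hdyn' : ∀ (r : ℝ≥0) (z : PhaseSpace N),
      (∫ y, w (y.1, -y.2) ∂((pinnedChain ω₂ lam β γ).transitionKernel N T T r z)) - w (z.1, -z.2) =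
        ∫ s in (0 : ℝ)..(r : ℝ), ∫ y, ℓ' y ∂((pinnedChain ω₂ lam β γ).transitionKernel N T T s.toNNReal z))
    (hbulk : ∀ z : PhaseSpace N, ℓ' (z.1, -z.2) = -ℓ z) {s : ℝ} (hs : 0 < s) :
    let μ : MeasureTheory.Measure (PhaseSpace N) := (pinnedChain ω₂ lam β γ).gibbsMeasure N T;
    let lap : ℝ → (PhaseSpace N → ℝ) → (PhaseSpace N → ℝ) → ℝ := fun s f g =>
      ∫ t in Set.Ioi (0 : ℝ), Real.exp (-(s * t)) *
        ((∫ z, f z * (∫ y, g y ∂((pinnedChain ω₂ lam β γ).transitionKernel N T T t.toNNReal z)) ∂μ) -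
          (∫ z, f z ∂μ) * (∫ z, g z ∂μ));
    let cov : (PhaseSpace N → ℝ) → (PhaseSpace N → ℝ) → ℝ := fun f g =>
      (∫ z, f z * g z ∂μ) - (∫ z, f z ∂μ) * (∫ z, g z ∂μ);
    lap s (fun z => f z + ℓ z) (fun z => f z + ℓ z) =
      lap s f f + s * (lap s f w - lap s w f) + s * cov w w - s ^ 2 * lap s w w := by
  intro μ lap cov
  have hN0 : 0 < N := by omega
  set Adm : (PhaseSpace N → ℝ) → Prop := fun f => Continuous f ∧ ∃ A : ℝ, ∀ z,
    |f z| ≤ A * Real.exp ((pinnedChain ω₂ lam β γ).hamiltonian N z / (8 * T)) with hAdmdef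
  set corr : (PhaseSpace N → ℝ) → (PhaseSpace N → ℝ) → ℝ → ℝ := fun f g t =>
    (∫ z, f z * (∫ y, g y ∂((pinnedChain ω₂ lam β γ).transitionKernel N T T t.toNNReal z)) ∂μ) -
      (∫ z, f z ∂μ) * (∫ z, g z ∂μ) with hcorrdef
  set e : Fin N → PhaseSpace N → ℝ := fun x z => z.2 x ^ 2 / 2 + (pinnedChain ω₂ lam β γ).U (z.1 x) +
    ∑ j : Fin N, ((if j.val = x.val + 1 then (pinnedChain ω₂ lam β γ).V (z.1 j - z.1 x) / 2 else 0) +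
      (if x.val = j.val + 1 then (pinnedChain ω₂ lam β γ).V (z.1 x - z.1 j) / 2 else 0)) with hedef
  set G : ℝ → Matrix (Fin N) (Fin N) ℝ := fun s => Matrix.of fun x y => lap s (e x) (e y) with hGdef
  have hAdm : ∀ f, Adm f ↔ (Continuous f ∧ ∃ A : ℝ, ∀ z,
      |f z| ≤ A * Real.exp ((pinnedChain ω₂ lam β γ).hamiltonian N z / (8 * T))) := fun f => Iff.rfl
  have hcorr : ∀ f g t, corr f g t =
      (∫ z, f z * (∫ y, g y ∂((pinnedChain ω₂ lam β γ).transitionKernel N T T t.toNNReal z)) ∂μ) -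
        (∫ z, f z ∂μ) * (∫ z, g z ∂μ) := fun f g t => rfl
  have hlap : ∀ s f g, lap s f g = ∫ t in Set.Ioi (0 : ℝ), Real.exp (-(s * t)) * corr f g t := fun s f g => rfl
  have hcov : ∀ f g, cov f g = (∫ z, f z * g z ∂μ) - (∫ z, f z ∂μ) * (∫ z, g z ∂μ) := fun f g => rfl
  have hFI := (feshbachIdentities_of hω hl hβ hγ hN hT e (fun _ _ => rfl) Adm rfl corr rfl lap rfl cov rfl G rfl).2.1
  exact lap_add_coboundary hAdm hcorr hlap hcov hFI hω hl hβ hγ hN0 hT hf hw hℓ hℓ' hdyn hdyn' hbulk hs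

end Summit.AtomisticToContinuum.FouriersLaw.Theorems.HonestZwanzig.Robin

end
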